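import Summits.PneNP.PneNP.Theorems.Sd2BlSigningStep
import Summits.PneNP.PneNP.Theorems.Sd2BlSigningGreedy
import Summits.PneNP.PneNP.Theorems.Sd2BlMachineDictClauses
import Summits.PneNP.PneNP.Theorems.Sd2BlPipeline

/-!
# Sign-degree-2 engine, THE CLOSER: the machine's signing is SIGN-CERTIFIED for the canonical certificate
# (cell pnp-ideate, ROUND-18 item K1'' `SignDeg2Signing.SignDeg2SigningFP`, stage S3)

FRONTIER (range avoidance for sign-degree-≤2 local maps at linear stretch; restricted-model algorithmic
rung); nothing here bears on P vs NP.

Assembly, twin of `SfmBlMachine.cutCertified_greedyBits` / `candCutNormSigningFP`: on the code of a `k`-local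
instance `I` all of whose tables have sign-degree `≤ 2`, with `n ≥ 1` and `m ≥ C(k)·n` (`C(k) = Sd2BlMachine.sd2C k`),
the polynomial-time machine `sd2StrK k` (`Sd2BlMachineConsts`) prints a signing `y` whose UNSIGNED LEG FUNCTIONAL over
the certificate legs `CLeg (cK I h)` is `< m` for all `±1` piece vectors (`legBound_sd2StrK`: prover-2's
`Sd2Bl.legBound_of_pipeline` instantiated with prover-1's dictionary D1i/D2i — `srcI/dstI/pI/V₁G/V₂G`,
`decomposition_clausesI_sd2`, `card_piecesI_le_real` — the machine semantics `traceSum_sd2_eq` / `hatSum_sd2_eq`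
(`Sd2BlSigningStep`) and the loop lemma `hgreedy_greedyBitsP` (`Sd2BlSigningGreedy`)); hence, by the K1'' interface
`SignDeg2Legs.sigCertified_of_legBound` with the owner compatibilities `own₁G_srcI / own₂G_dstI`, `B = m`, `τ = 2`:
**`sigCertified_sd2StrK`** — `y` is sign-certified for `cK I h` (= `SignDeg2Signing.canonCert I h`), i.e. the body of
`SignDeg2Signing.SigCertified I (canonCert I h) y`.  The by-name leaf `SignDeg2SigningFP k` is the companion file.
-/

set_option linter.dupNamespace false -- `Summit.PneNP.PneNP.…`: summit = sub-problem name (D-0017 single-conjunct layout)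

namespace Summit.PneNP.PneNP.Theorems.Sd2BlMachine

open Finset Matrix Literature.Computability.Complexity
open Summit.PneNP.PneNP.Theorems.SfmBlMachine
open Summit.PneNP.PneNP.Theorems.CandCutNorm (boolSign)
open Summit.PneNP.PneNP.Theorems.SfmBl (IsConnectedPair bipGraph)
open Summit.PneNP.PneNP.Theorems.SignRepCertificate (Cert pm bias load pairForm)
open Summit.PneNP.PneNP.Theorems.SignDeg2Legs (Kind coef CLeg srcOwner dstOwner sigCertified_of_legBound)
open Summit.PneNP.PneNP.Theorems.SignDegCertBridge (certOf certOfIntCert)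

variable {k n m : ℕ}

/-! ## The decomposition clauses for the machine's state -/

/-- prover-1's `decomposition_clausesI_sd2` for the machine's own parameters (`t₀'`, cap `(40N)^(4t+1)`,
`|plegs| + 1` rounds); `st` = the machine's extraction state, kept as a variable. -/
theorem decomp_sd2 (I : LocalMap k n m) (h : ∀ j, SignDegLE 2 (I.table j)) (hN1 : 1 ≤ gN (plegsK I))
    (st : List ℕ × ℕ) (hst : gExtract (ellK k) (tK k) (plegsK I) = st) :
    ∃ hlab : ∀ lab ∈ st.1, lab ≤ st.2,
      (∀ (W₁ : Finset (LPieceG (gL (tK k)) (rawI I (F0k k) (F1k k) (F2k k))))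
          (W₂ : Finset (RPieceG (gL (tK k)) (rawI I (F0k k) (F1k k) (F2k k)))),
        ((bipGraph (fun i q => ∃ e : CLeg (cK I h),
            srcI I (cK I h) (F0k k) (F1k k) (F2k k) (coef_canon_eq_coefF I h) (gL (tK k)) e = i ∧
            dstI I (cK I h) (F0k k) (F1k k) (F2k k) (coef_canon_eq_coefF I h) (gL (tK k)) e = q)).induce
            {x | Sum.elim (fun i => i ∈ W₁) (fun q => q ∈ W₂) x}).Connected →
        W₁.card + W₂.card ≤ pT0' (gN (plegsK I)) →
        ((Finset.univ.filter fun e : CLeg (cK I h) =>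
            pI I (cK I h) (F0k k) (F1k k) (F2k k) (coef_canon_eq_coefF I h) st.1 st.2 hlab e = none ∧
            srcI I (cK I h) (F0k k) (F1k k) (F2k k) (coef_canon_eq_coefF I h) (gL (tK k)) e ∈ W₁ ∧
            dstI I (cK I h) (F0k k) (F1k k) (F2k k) (coef_canon_eq_coefF I h) (gL (tK k)) e ∈ W₂).card : ℝ)
          ≤ (4 * ellK k * Real.sqrt (34 * ellK k * (2 : ℝ) ^ (2 * tK k) * (2 * tK k : ℕ)))
            * Real.sqrt ((W₁.card : ℝ) * (W₂.card : ℝ))) ∧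
      (∀ (s : Fin st.2) (e : CLeg (cK I h)),
        pI I (cK I h) (F0k k) (F1k k) (F2k k) (coef_canon_eq_coefF I h) st.1 st.2 hlab e = some s →
        srcI I (cK I h) (F0k k) (F1k k) (F2k k) (coef_canon_eq_coefF I h) (gL (tK k)) e
            ∈ V₁G (gL (tK k)) (rawI I (F0k k) (F1k k) (F2k k)) st.1 st.2 hlab s ∧
          dstI I (cK I h) (F0k k) (F1k k) (F2k k) (coef_canon_eq_coefF I h) (gL (tK k)) e
            ∈ V₂G (gL (tK k)) (rawI I (F0k k) (F1k k) (F2k k)) st.1 st.2 hlab s) ∧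
      (∀ s : Fin st.2, (4 * ellK k * Real.sqrt (34 * ellK k * (2 : ℝ) ^ (2 * tK k) * (2 * tK k : ℕ))) *
          Real.sqrt (((V₁G (gL (tK k)) (rawI I (F0k k) (F1k k) (F2k k)) st.1 st.2 hlab s).card : ℝ)
            * ((V₂G (gL (tK k)) (rawI I (F0k k) (F1k k) (F2k k)) st.1 st.2 hlab s).card : ℝ))
        < ((Finset.univ.filter fun e : CLeg (cK I h) =>
            pI I (cK I h) (F0k k) (F1k k) (F2k k) (coef_canon_eq_coefF I h) st.1 st.2 hlab e = some s).card : ℝ)) ∧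
      (∀ s : Fin st.2, (V₁G (gL (tK k)) (rawI I (F0k k) (F1k k) (F2k k)) st.1 st.2 hlab s).card
          + (V₂G (gL (tK k)) (rawI I (F0k k) (F1k k) (F2k k)) st.1 st.2 hlab s).card
        ≤ 2 * (Finset.univ.filter fun e : CLeg (cK I h) =>
            pI I (cK I h) (F0k k) (F1k k) (F2k k) (coef_canon_eq_coefF I h) st.1 st.2 hlab e = some s).card) := by
  obtain ⟨_, hT0, _, hL2t0, _⟩ := g_bounds hN1 (tK k)
  have ht0' := pT0'_eq hN1
  have hcap : ∀ k', k' ≤ (List.replicate (2 * (pT0' (gN (plegsK I)) - 1)) ()).length →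
      (walksU (pieceLegsG (gL (tK k)) (rawI I (F0k k) (F1k k) (F2k k))) k').length ≤ gCapW (tK k) (plegsK I) := by
    intro k' hk'
    rw [List.length_replicate, ht0'] at hk'
    refine (length_walksU_pieceLegsG_le (gL_pos _) _ k').trans ?_
    rw [← plegsK_eq]
    unfold gCapW
    change gN (plegsK I) * gL (tK k) ^ k' ≤ _
    calc gN (plegsK I) * gL (tK k) ^ k' ≤ gN (plegsK I) * gL (tK k) ^ (2 * pT0 (gN (plegsK I))) :=
          Nat.mul_le_mul_left _ (Nat.pow_le_pow_right (gL_pos _) (by omega))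
      _ ≤ (40 * gN (plegsK I)) * (40 * gN (plegsK I)) ^ (4 * tK k) := Nat.mul_le_mul (by omega) hL2t0
      _ = (40 * gN (plegsK I)) ^ (4 * tK k + 1) := by ring
  have hu₂ : (pieceLegsG (gL (tK k)) (rawI I (F0k k) (F1k k) (F2k k))).length
      < (List.replicate ((plegsK I).length + 1) ()).length := by
    rw [List.length_replicate, ← plegsK_eq]; exact Nat.lt_succ_self _
  have hd := decomposition_clausesI_sd2 I (cK I h) (F0k k) (F1k k) (F2k k) (coef_canon_eq_coefF I h) (gL (tK k))
    (ellK k) (tK k) (gCapW (tK k) (plegsK I)) (pT0' (gN (plegsK I)))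
    (List.replicate (2 * (pT0' (gN (plegsK I)) - 1)) ()) List.length_replicate hcap
    (List.replicate ((plegsK I).length + 1) ()) hu₂
  have e : extract (gRsq (ellK k) (tK k)) (pieceLegsG (gL (tK k)) (rawI I (F0k k) (F1k k) (F2k k)))
      (cands (pieceLegsG (gL (tK k)) (rawI I (F0k k) (F1k k) (F2k k))) (gCapW (tK k) (plegsK I)) (pT0' (gN (plegsK I)))
        (List.replicate (2 * (pT0' (gN (plegsK I)) - 1)) ()))
      (List.replicate ((plegsK I).length + 1) ()) = st := hst
  subst e
  exact hd

/-! ## The constants of the integer comparison -/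

/-- `V = Σ_s (|V₁ s| + |V₂ s|)` for the machine's `gV`. -/
theorem gV_eq (I : LocalMap k n m) (h : ∀ j, SignDegLE 2 (I.table j)) (st : List ℕ × ℕ)
    (hst : gExtract (ellK k) (tK k) (plegsK I) = st) (hlab : ∀ lab ∈ st.1, lab ≤ st.2) :
    gV (ellK k) (tK k) (plegsK I) = ∑ s : Fin st.2,
      ((V₁G (gL (tK k)) (rawI I (F0k k) (F1k k) (F2k k)) st.1 st.2 hlab s).card
        + (V₂G (gL (tK k)) (rawI I (F0k k) (F1k k) (F2k k)) st.1 st.2 hlab s).card) := by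
  unfold gV
  rw [gR'_eq, hst, sum_map_range_eq, ← Fin.sum_univ_eq_sum_range]
  refine Finset.sum_congr rfl fun s _ => ?_
  rw [card_V₁G_eq_length_lpieces I h st hst hlab s, card_V₂G_eq_length_rpieces I h st hst hlab s]

/-! ## The leg bound -/

/-- **THE SIGNING OF THE MACHINE SATISFIES THE LEG BOUND** (`n ≥ 1`, `m ≥ C(k)·n`): the unsigned leg functional of
the certificate leg system over the machine's pieces is `< m` for every `±1` piece vector. -/
theorem legBound_sd2StrK (I : LocalMap k n m) (h : ∀ j, SignDegLE 2 (I.table j)) (hn : 0 < n) (hm : sd2C k * n ≤ m) :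
    ∀ (σ' : LPieceG (gL (tK k)) (rawI I (F0k k) (F1k k) (F2k k)) → ℝ)
      (φ' : RPieceG (gL (tK k)) (rawI I (F0k k) (F1k k) (F2k k)) → ℝ),
      (∀ i, σ' i = 1 ∨ σ' i = -1) → (∀ q, φ' q = 1 ∨ φ' q = -1) →
      ∑ e : CLeg (cK I h), ((boolSign (readOut m (sd2StrK k I.encode) e.out) : ℤ) : ℝ)
          * σ' (srcI I (cK I h) (F0k k) (F1k k) (F2k k) (coef_canon_eq_coefF I h) (gL (tK k)) e)
          * φ' (dstI I (cK I h) (F0k k) (F1k k) (F2k k) (coef_canon_eq_coefF I h) (gL (tK k)) e) < (m : ℝ) := by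
  classical
  have hm0 : 0 < m := pos_of_stretch hn hm
  have hN1 : 1 ≤ gN (plegsK I) := one_le_gN I h hm0
  have hNeq : gN (plegsK I) = Fintype.card (LPieceG (gL (tK k)) (rawI I (F0k k) (F1k k) (F2k k)))
      + Fintype.card (RPieceG (gL (tK k)) (rawI I (F0k k) (F1k k) (F2k k))) := by
    unfold gN; rw [plegsK_eq]; exact length_pieces_eq_card_G _ _
  obtain ⟨hlab, hsp', hsides, hdense, hcov⟩ := decomp_sd2 I h hN1 _ rfl
  have hsp := fun W₁ W₂ hc (hs : W₁.card + W₂.card ≤ pT0 (gN (plegsK I))) =>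
    hsp' W₁ W₂ hc (by rw [pT0'_eq hN1]; exact hs)
  -- parameters
  have hb : pB (gN (plegsK I)) = pB (Fintype.card (LPieceG (gL (tK k)) (rawI I (F0k k) (F1k k) (F2k k)))
      + Fintype.card (RPieceG (gL (tK k)) (rawI I (F0k k) (F1k k) (F2k k)))) := by rw [← hNeq]
  have hj : pJ1 (gN (plegsK I)) - 1 + 1 = pJ1 (Fintype.card (LPieceG (gL (tK k)) (rawI I (F0k k) (F1k k) (F2k k)))
      + Fintype.card (RPieceG (gL (tK k)) (rawI I (F0k k) (F1k k) (F2k k)))) := by rw [pJ1_sub_add hN1, ← hNeq]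
  have ht : pT0 (gN (plegsK I)) = pT0 (Fintype.card (LPieceG (gL (tK k)) (rawI I (F0k k) (F1k k) (F2k k)))
      + Fintype.card (RPieceG (gL (tK k)) (rawI I (F0k k) (F1k k) (F2k k)))) := by rw [← hNeq]
  obtain ⟨hNb, ht₀, hjj⟩ := g_params_spec_real hb hj ht
  -- pieces, degrees
  haveI := nonempty_CLeg I h hm0
  have hN : ((Fintype.card (LPieceG (gL (tK k)) (rawI I (F0k k) (F1k k) (F2k k))) : ℝ)
      + Fintype.card (RPieceG (gL (tK k)) (rawI I (F0k k) (F1k k) (F2k k))))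
      ≤ 8 * n + 2 * ellK k * m / (2 : ℝ) ^ (2 * tK k) := by
    have := card_piecesI_le_real I (cK I h) (F0k k) (F1k k) (F2k k) (coef_canon_eq_coefF I h)
      (gL_pos (tK k)) hn (card_legs_out_le_ellK I h)
    have e : ((gL (tK k) : ℕ) : ℝ) = (2 : ℝ) ^ (2 * tK k) := by unfold gL; push_cast; ring
    rw [e] at this
    exact this
  have hN1' := one_le_card_piecesI I (cK I h) (F0k k) (F1k k) (F2k k) (coef_canon_eq_coefF I h) (gL (tK k))
  -- the fractions
  set V : ℕ := ∑ s : Fin (gExtract (ellK k) (tK k) (plegsK I)).2,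
      ((V₁G (gL (tK k)) (rawI I (F0k k) (F1k k) (F2k k)) (gExtract (ellK k) (tK k) (plegsK I)).1
          (gExtract (ellK k) (tK k) (plegsK I)).2 hlab s).card
        + (V₂G (gL (tK k)) (rawI I (F0k k) (F1k k) (F2k k)) (gExtract (ellK k) (tK k) (plegsK I)).1
          (gExtract (ellK k) (tK k) (plegsK I)).2 hlab s).card) with hV
  obtain ⟨hp₁, hq₁, hp₂, hq₂⟩ := g_fracs_pos (Fintype.card (LPieceG (gL (tK k)) (rawI I (F0k k) (F1k k) (F2k k))) + Fintype.card (RPieceG (gL (tK k)) (rawI I (F0k k) (F1k k) (F2k k)))) (gRad (ellK k) (tK k)) (2 ^ (pJ1 (gN (plegsK I)) - 1 + 2)) V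
    (gL (tK k)) (gL_pos _)
  have hC₁ : gC₁ (ellK k) (tK k) (plegsK I) = 6 * (4 * V + gL (tK k) ^ 10) * 1 := by
    unfold gC₁; rw [gV_eq I h _ rfl hlab, mul_one]
  have hC₂ : gC₂ (ellK k) (tK k) (plegsK I)
      = 10 * ((Fintype.card (LPieceG (gL (tK k)) (rawI I (F0k k) (F1k k) (F2k k))) + Fintype.card (RPieceG (gL (tK k)) (rawI I (F0k k) (F1k k) (F2k k))))
          * gRad (ellK k) (tK k) ^ (2 ^ (pJ1 (gN (plegsK I)) - 1 + 2)) + 1) * (5 * gL (tK k) ^ 10) := by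
    unfold gC₂; rw [gEll_eq _ hN1, ← hNeq]; ring
  -- the pipeline
  refine Sd2Bl.legBound_of_pipeline
    (srcI I (cK I h) (F0k k) (F1k k) (F2k k) (coef_canon_eq_coefF I h) (gL (tK k)))
    (dstI I (cK I h) (F0k k) (F1k k) (F2k k) (coef_canon_eq_coefF I h) (gL (tK k)))
    (fun e : CLeg (cK I h) => e.out) (three_le_ellK k) (card_legs_out_le_ellK I h) (tK k) (one_le_tK k)
    (size_condition_tK k) hn (stretch_of_sd2C hm)
    (fun i => card_filter_srcI_le I (cK I h) (F0k k) (F1k k) (F2k k) (coef_canon_eq_coefF I h) (gL_pos (tK k)) i)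
    (fun q => card_filter_dstI_le I (cK I h) (F0k k) (F1k k) (F2k k) (coef_canon_eq_coefF I h) (gL_pos (tK k)) q)
    hN1' hN (pJ1 (gN (plegsK I)) - 1) (pB (gN (plegsK I))) (pT0 (gN (plegsK I))) hNb ht₀ hjj
    (gExtract (ellK k) (tK k) (plegsK I)).2
    (pI I (cK I h) (F0k k) (F1k k) (F2k k) (coef_canon_eq_coefF I h)
      (gExtract (ellK k) (tK k) (plegsK I)).1 (gExtract (ellK k) (tK k) (plegsK I)).2 hlab)
    (V₁G (gL (tK k)) (rawI I (F0k k) (F1k k) (F2k k)) (gExtract (ellK k) (tK k) (plegsK I)).1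
      (gExtract (ellK k) (tK k) (plegsK I)).2 hlab)
    (V₂G (gL (tK k)) (rawI I (F0k k) (F1k k) (F2k k)) (gExtract (ellK k) (tK k) (plegsK I)).1
      (gExtract (ellK k) (tK k) (plegsK I)).2 hlab)
    hsp hsides hdense hcov
    (MpS I h (gExtract (ellK k) (tK k) (plegsK I)) hlab) (fun _ _ _ _ => rfl)
    (WS I h (gExtract (ellK k) (tK k) (plegsK I)) hlab) (mem_WS_iff I h _ hlab)
    (badS I h (gExtract (ellK k) (tK k) (plegsK I)) hlab) (mem_badS_iff I h _ hlab) _ (fun _ => rfl)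
    (readOut m (sd2StrK k I.encode)) fun kq hkq => ?_
  -- the greedy hypothesis
  rw [readOut_sd2StrK]
  refine hgreedy_greedyBitsP (gPot (ellK k) (tK k) m (plegsK I))
    (fun T => ((Matrix.fromBlocks 0 (MpS I h (gExtract (ellK k) (tK k) (plegsK I)) hlab T none)
      (MpS I h (gExtract (ellK k) (tK k) (plegsK I)) hlab T none)ᵀ 0) ^ (2 ^ (pJ1 (gN (plegsK I)) - 1 + 2))).trace)
    (fun T => ∑ s, ∑ W ∈ badS I h (gExtract (ellK k) (tK k) (plegsK I)) hlab s T,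
      ((Finset.univ.filter fun e : CLeg (cK I h) =>
        (srcI I (cK I h) (F0k k) (F1k k) (F2k k) (coef_canon_eq_coefF I h) (gL (tK k)) e ∈ W.1 ∨
          dstI I (cK I h) (F0k k) (F1k k) (F2k k) (coef_canon_eq_coefF I h) (gL (tK k)) e ∈ W.2) ∧
        pI I (cK I h) (F0k k) (F1k k) (F2k k) (coef_canon_eq_coefF I h)
          (gExtract (ellK k) (tK k) (plegsK I)).1 (gExtract (ellK k) (tK k) (plegsK I)).2 hlab e = some s).card : ℝ))
    (fun kk T0 => traceSum kk T0 (2 ^ (m - kk + 1)) (gRlegs (ellK k) (tK k) (plegsK I)) (gCapA (tK k) (plegsK I)) (gUA (plegsK I)))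
    (fun kk T0 => hatSum (gG (ellK k) (tK k)) kk T0 m (gRecs (ellK k) (tK k) (plegsK I)))
    (fun kk hkk T0 => ?_) (fun kk hkk T0 => ?_) hp₁ hq₁ hp₂ hq₂ hC₁ hC₂ (fun _ _ => rfl) _ (fun T => ?_) kq hkq
  · -- M3-SEM
    have h3 := traceSum_sd2_eq I h hN1 _ rfl hlab hkk T0
    have e2 : 2 * pQ1' (gN (plegsK I)) = 2 ^ (pJ1 (gN (plegsK I)) - 1 + 2) := gEll_eq _ hN1
    rw [e2] at h3
    exact h3
  · -- M4-SEM
    have h4 := hatSum_sd2_eq I h hN1 _ rfl hlab kk T0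
    unfold meetS at h4
    show ((hatSum (gG (ellK k) (tK k)) kk T0 m (gRecs (ellK k) (tK k) (plegsK I)) : ℕ) : ℝ) = _
    unfold gRecs
    rw [gR'_eq]
    exact h4
  · -- the shape of `F`: `A₁ = p₁/q₁`, `A₃ = p₂/q₂`
    have eA₁ : (10 : ℝ) * (((Fintype.card (LPieceG (gL (tK k)) (rawI I (F0k k) (F1k k) (F2k k))) : ℝ)
          + Fintype.card (RPieceG (gL (tK k)) (rawI I (F0k k) (F1k k) (F2k k))))
        * (2400 * (ellK k : ℝ) ^ 2 * (2 * tK k : ℕ) * ((2 * tK k : ℕ) + 1) * (2 : ℝ) ^ tK k)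
          ^ (2 ^ (pJ1 (gN (plegsK I)) - 1 + 2)) + 1)
        = ((10 * ((Fintype.card (LPieceG (gL (tK k)) (rawI I (F0k k) (F1k k) (F2k k))) + Fintype.card (RPieceG (gL (tK k)) (rawI I (F0k k) (F1k k) (F2k k))))
            * gRad (ellK k) (tK k) ^ (2 ^ (pJ1 (gN (plegsK I)) - 1 + 2)) + 1) : ℕ) : ℝ) / ((1 : ℕ) : ℝ) := by
      unfold gRad; push_cast; ring
    have eA₃ : (6 : ℝ) / 5 * (∑ s : Fin (gExtract (ellK k) (tK k) (plegsK I)).2,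
        4 * (((V₁G (gL (tK k)) (rawI I (F0k k) (F1k k) (F2k k)) (gExtract (ellK k) (tK k) (plegsK I)).1
              (gExtract (ellK k) (tK k) (plegsK I)).2 hlab s).card : ℝ)
          + (V₂G (gL (tK k)) (rawI I (F0k k) (F1k k) (F2k k)) (gExtract (ellK k) (tK k) (plegsK I)).1
              (gExtract (ellK k) (tK k) (plegsK I)).2 hlab s).card)
          * (((2 : ℝ) ^ (2 * tK k)) ^ 10)⁻¹ + 1)
        = ((6 * (4 * V + gL (tK k) ^ 10) : ℕ) : ℝ) / ((5 * gL (tK k) ^ 10 : ℕ) : ℝ) := by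
      rw [← g_A₃_frac V (gL (tK k)) (gL_pos _)]
      have e : ((gL (tK k) : ℕ) : ℝ) = (2 : ℝ) ^ (2 * tK k) := by unfold gL; push_cast; ring
      rw [e, hV]
      push_cast
      have hs : ∑ s : Fin (gExtract (ellK k) (tK k) (plegsK I)).2,
          (4 : ℝ) * (((V₁G (gL (tK k)) (rawI I (F0k k) (F1k k) (F2k k)) (gExtract (ellK k) (tK k) (plegsK I)).1
              (gExtract (ellK k) (tK k) (plegsK I)).2 hlab s).card : ℝ)
            + (V₂G (gL (tK k)) (rawI I (F0k k) (F1k k) (F2k k)) (gExtract (ellK k) (tK k) (plegsK I)).1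
              (gExtract (ellK k) (tK k) (plegsK I)).2 hlab s).card) * (((2 : ℝ) ^ (2 * tK k)) ^ 10)⁻¹
          = 4 * (∑ s : Fin (gExtract (ellK k) (tK k) (plegsK I)).2,
            (((V₁G (gL (tK k)) (rawI I (F0k k) (F1k k) (F2k k)) (gExtract (ellK k) (tK k) (plegsK I)).1
              (gExtract (ellK k) (tK k) (plegsK I)).2 hlab s).card : ℝ)
            + (V₂G (gL (tK k)) (rawI I (F0k k) (F1k k) (F2k k)) (gExtract (ellK k) (tK k) (plegsK I)).1
              (gExtract (ellK k) (tK k) (plegsK I)).2 hlab s).card)) * (((2 : ℝ) ^ (2 * tK k)) ^ 10)⁻¹ := by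
        rw [Finset.mul_sum, Finset.sum_mul]
      rw [hs]
    -- M4-SEM statement uses `meetS`; unfold it in `h4` form is not needed here: `hat` is explicit
    rw [eA₁, eA₃]

/-! ## The certificate -/

/-- **THE MACHINE'S SIGNING IS SIGN-CERTIFIED FOR THE CANONICAL CERTIFICATE** (`n ≥ 1`, `m ≥ C(k)·n`): the body
of `SignDeg2Signing.SigCertified I (canonCert I h) (readOut m (sd2StrK k I.encode))`. -/
theorem sigCertified_sd2StrK (I : LocalMap k n m) (h : ∀ j, SignDegLE 2 (I.table j)) (hn : 0 < n)
    (hm : sd2C k * n ≤ m) :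
    ∃ e : ℤ, (∀ X : Fin n → ℤ, (∀ v, X v = 1 ∨ X v = -1) →
        pairForm I (cK I h) (fun j => pm (readOut m (sd2StrK k I.encode) j)) X ≤ e) ∧
      bias I (cK I h) (fun j => pm (readOut m (sd2StrK k I.encode) j))
        + ∑ v, |load I (cK I h) (fun j => pm (readOut m (sd2StrK k I.encode) j)) v| + e < (cK I h).τ * m := by
  have hm0 : 0 < m := pos_of_stretch hn hm
  refine sigCertified_of_legBound I (cK I h) (readOut m (sd2StrK k I.encode))
    (srcI I (cK I h) (F0k k) (F1k k) (F2k k) (coef_canon_eq_coefF I h) (gL (tK k)))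
    (dstI I (cK I h) (F0k k) (F1k k) (F2k k) (coef_canon_eq_coefF I h) (gL (tK k)))
    (own₁G (gL (tK k)) (rawI I (F0k k) (F1k k) (F2k k)) n) (own₂G (gL (tK k)) (rawI I (F0k k) (F1k k) (F2k k)) n)
    (own₁G_srcI I (cK I h) (F0k k) (F1k k) (F2k k) (coef_canon_eq_coefF I h) (gL (tK k)))
    (own₂G_dstI I (cK I h) (F0k k) (F1k k) (F2k k) (coef_canon_eq_coefF I h) (gL (tK k)))
    (m : ℝ) (fun σ' φ' hσ' hφ' => (legBound_sd2StrK I h hn hm σ' φ' hσ' hφ').le) ?_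
  have hτ : ((cK I h).τ : ℝ) = 2 := by rw [canonCert_τ_eq_two I h]; norm_num
  rw [hτ]
  have : (0 : ℝ) < m := by exact_mod_cast hm0
  linarith

end Summit.PneNP.PneNP.Theorems.Sd2BlMachine
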